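/-
Copyright: statement-level skeleton of a published paper (lit-balaban cell, Phase-2 proof seat p25, gen 19). No proof
claims beyond what the kernel checks below.
-/
import Literature.MathematicalPhysics.QuantumFieldTheory.BalabanImbrieJaffe1984to88.BIJ88WalkRemainderActivity312
import Literature.MathematicalPhysics.QuantumFieldTheory.BalabanImbrieJaffe1984to88.BIJ88WalkResummationDisplay312

/-!
# `BalabanImbrieJaffe1984to88.BIJ88WalkLocatedDisplay312` — T. Bałaban, J. Imbrie, A. Jaffe, *Effective action and
cluster properties of the abelian Higgs model*, Commun. Math. Phys. **114** (1988) 257–315 [BalabanImbrieJaffe1988],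
§5.14 p. 312 [PDF 56], verbatim (first display): *"Then the result of the integration by parts is
z_F/Z = ⟨Π_{σ_1} F^{m̄}_{k,loc}(X_{σ_1})⟩_1 = Σ_{{X_r}} Π_c F^L_{k+1,loc}(X_c) ⟨Π_r F_{k,rem}(X_r)⟩_1, where ⟨·⟩_1 is the
interacting expectation at t = 1."* (x2 render `lit-balaban-r16/renders/cmp114/original-p056-x2.png`), *"We can arrange the construction so that the {X_c} are
determined once the remainder components are specified."* — **THE FIRST DISPLAY IN LOCATED FORM** (p25 gen 19): the
Gaussian integral of a product of observables against `χe^{−V}dμ_{C,ℱ}`, integrated by parts with the covariance split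
(`BIJ88WalkIdentity311.expand_val_init`), resummed over the constant components (`BIJ88WalkResummation312.expand_resum`,
`BIJ88WalkResummationDisplay312.cst_eq_sum_setPartitions`) and localized (`BIJ88WalkRemainderActivity312.sum_remAt_eq_remv`),
reads: `∫ Π_{j∈K}Π_{w∈obs j}Φ(w)·χe^{−V}dμ = Σ_{O ⊆ K} (Σ_{π ∈ set partitions of K∖O} Π_{Q∈π} F^L(Q)) · Σ_{𝒳} remAt(O, 𝒳)`
(`located_display`) — the observables `K ∖ O` organised into constant blocks `Q` (each `F^L(Q) = Σ_X flAt(min Q, Q∖min Q, X)`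
a sum of activities localized at cube sets, `BIJ88WalkResummationDisplay312.flBlock_eq_sum_flAt`), the observables `O` into
located remainder families `𝒳 = {(obs of X_r, cubes of X_r)}_r`; on the §5.13 law, normalized by `Z`, the same with
`remAt/Z` (`located_display_fieldLaw`).  Every factor is bounded in the printed currency by the siblings
(`BIJ88WalkIneq312Blocks.ineq312_blocks`, `BIJ88WalkIneq312Remainder.ineq312_remainder`).

statement-level skeleton of published theorems with citation tags; proofs where landed; nothing here is a claim
about the Yang–Mills mass gap

PDF held: `paper:balaban1988-cmp114-bij-abelian-higgs-effective-action` (journal page = PDF page + 256); p. 312 =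
PDF 56 (`p0056.txt` L2–9 re-read this session, 2026-08-23).

CITATION HEADER (lean-in-tree rule).  lit-balaban cell (HOME `run/shared/lean/pub/lit-balaban/`), Phase 2, seat p25
gen 19; row **C2.Claim@312** of `HOME/lit-balaban-r16/ROWS-C2-part2.md` (owner r16, referee ref-5; head
`BIJ88Sect5StatementsPart4.Ineq312` untouched in this file — MEMBER of the row).  USED BY NAME, nothing restated:
`BIJ88WalkIdentity311.{gintM, expand_val_init}`, `BIJ88WalkResummation312.{cst, remv, expand_resum}`,
`BIJ88WalkResummationDisplay312.{flBlock, cst_eq_sum_setPartitions}`, `BIJ88WalkRemainderActivity312.{rloc, remAt,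
sum_remAt_eq_remv}`, `BIJ88LabelledRemainderFieldLaw312.gintM_eq_mul_integral_fieldLaw`,
`BIJ88LabelledExpansion311.gintM`, `Literature.Probability.LatticeModels.setPartitions`, the §5.13 model `prec`/`src`/`fieldLaw`.

## What is proved (0 `sorry`, standard axioms, no new `Prop` facts; theorems only)

* **`located_display`** (general Gaussian data `A ≻ 0`, source `f`, cutoff `χ` with bounded `(Π∂)χ·e^{−V}`, split
  `Σ_p Cov p = A⁻¹`), **`located_display_fieldLaw`** (the §5.13 law, normalized).
HONEST SCOPE: identities only; contraction-graph components; `⟨Π_r F_{k,rem}(X_r)⟩` localized at the family `{X_r}`,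
print's final cluster expansion into `Π G_k(X_{r′})` not done; no `Ineq312` binder here.  NOT summit progress; NOT
continuum; NOT Clay.  Imports `BIJ88WalkRemainderActivity312`, `BIJ88WalkResummationDisplay312`; modifies nothing.
-/

noncomputable section

namespace Literature.MathematicalPhysics.QuantumFieldTheory.BalabanImbrieJaffe1984to88.BIJ88WalkLocatedDisplay312

open Classical MeasureTheory Matrix Finset
open scoped BigOperators
open Literature.Probability.LatticeModels (setPartitions)
open Literature.MathematicalPhysics.QuantumFieldTheory.Balaban1983to89
open B2Eq228Conditioning (weight source)
open BIJ88PolymerRep5134 (corner)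
open BIJ88PolymerRep5134Gauss (prec src)
open BIJ88SlotMomentsGauss308 (fieldLaw integral_density_pos)
open BIJ88VertexIbp311 (vexp)
open BIJ88WickDerivatives305 (dlist dlist_nil)
open BIJ88LabelledExpansion311 (gintM)
open BIJ88LabelledRemainderFieldLaw312 (gintM_eq_mul_integral_fieldLaw)
open BIJ88WalkRun311 BIJ88WalkExpansion311 BIJ88WalkIdentity311 BIJ88WalkResummation312 BIJ88WalkResummationDisplay312
  BIJ88WalkRemainderActivity312

variable {S : Type} [Fintype S] {ι : Type} [Fintype ι] {κ : Type} [LinearOrder κ] {P : Type} [Fintype P]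
  {β : Type} [DecidableEq β]

/-- **THE FIRST DISPLAY OF p. 312 IN LOCATED FORM**: for observables `K` with legs `obs`, Gaussian data `A ≻ 0` with
source `f`, cutoff `χ` (every `(Π_D∂)χ` of class `C¹`, `(Π_D∂)χ·e^{−V}` bounded) and the covariance split
`Σ_p Cov p = A⁻¹`:
`∫ Π_{j∈K}Π_{w∈obs j}Φ(w)·χe^{−V}dμ_{A⁻¹,f} = Σ_{O ⊆ K} (Σ_{π ∈ setPartitions (K∖O)} Π_{Q∈π} flBlock Q) · Σ_{𝒳} remAt [] 0 O 𝒳`,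
the last sum over the located remainder families of the terms of `expand 0 O`. [cite: BalabanImbrieJaffe1988, §5.14 p.312] -/
theorem located_display {A : Matrix S S ℝ} {Cov : P → Matrix S S ℝ} {trig : P → Bool} {f : S → ℝ} {c : ι → ℝ}
    {legs : ι → List (S → ℝ)} {obs : κ → List (S → ℝ)} {M : ℕ} {χ : (S → ℝ) → ℝ}
    (oc : κ → Finset β) (vc : ι → Finset β) (reg : P → Finset β)
    (hA : A.PosDef) (hχ : ∀ D : List (S → ℝ), ContDiff ℝ 1 (dlist D χ))
    (h0 : ∀ D : List (S → ℝ), ∃ K, ∀ φ, ‖dlist D χ φ * vexp c legs φ‖ ≤ K) (hCov : ∑ p, Cov p = A⁻¹) (K : Finset κ) :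
    gintM A f c legs χ ((K.val.map fun j => (obs j : Multiset (S → ℝ))).sum) []
      = ∑ O ∈ K.powerset,
          (∑ π ∈ setPartitions (K \ O), ∏ Q ∈ π, flBlock Cov trig f c legs obs M Q)
            * ∑ 𝒳 ∈ ((expand Cov trig f c legs obs M 0 O).map (rloc oc vc reg)).toFinset,
                remAt A Cov trig f c legs obs M χ oc vc reg [] 0 O 𝒳 := by
  rw [expand_val_init (trig := trig) (obs := obs) (M := M) hA hχ h0 hCov K,
    expand_resum (A := A) (Cov := Cov) (trig := trig) (f := f) (c := c) (legs := legs) (obs := obs) (M := M) (χ := χ)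
      _ 0 K (Nat.lt_succ_self _) (fun _ hh => absurd hh (Multiset.notMem_zero _)) []]
  refine Finset.sum_congr rfl fun O _ => ?_
  rw [cst_eq_sum_setPartitions (Cov := Cov) (trig := trig) (f := f) (c := c) (legs := legs) (obs := obs) (M := M) _
      (K \ O) (Nat.lt_succ_self _),
    sum_remAt_eq_remv [] 0 O _ fun t ht _ => Multiset.mem_toFinset.2 (Multiset.mem_map_of_mem _ ht)]

variable {α I : Type} [Fintype α] [DecidableEq α] [Fintype I] [DecidableEq I]
  {blk : α → I} {Δ : Matrix α α ℝ} {ℱ : α → ℝ} {W : Finset I}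

/-- **… ON THE §5.13 LAW, NORMALIZED** (*"where ⟨·⟩_1 is the interacting expectation at t = 1"* — here the Gaussian law
`ℙ_W` of the model of record with the interaction and cutoff under the expectation):
`𝔼_W[Π_{j∈K}Π_{w∈obs j}Φ(w)·χ·e^{−V}] = Σ_{O ⊆ K} (Σ_{π} Π_{Q∈π} flBlock Q) · Σ_{𝒳} remAt(O,𝒳)/Z`.
[cite: BalabanImbrieJaffe1988, §5.14 p.312] -/
theorem located_display_fieldLaw (hPD : (prec blk Δ W (corner ℝ W)).PosDef)
    {Cov : P → Matrix {x : α // blk x ∈ W} {x : α // blk x ∈ W} ℝ} {trig : P → Bool} {c : ι → ℝ}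
    {legs : ι → List ({x : α // blk x ∈ W} → ℝ)} {obs : κ → List ({x : α // blk x ∈ W} → ℝ)} {M : ℕ}
    {χ : ({x : α // blk x ∈ W} → ℝ) → ℝ} (oc : κ → Finset β) (vc : ι → Finset β) (reg : P → Finset β)
    (hχ : ∀ D : List ({x : α // blk x ∈ W} → ℝ), ContDiff ℝ 1 (dlist D χ))
    (h0 : ∀ D : List ({x : α // blk x ∈ W} → ℝ), ∃ K, ∀ φ, ‖dlist D χ φ * vexp c legs φ‖ ≤ K)
    -- the abstract lane's `A⁻¹` (`BIJ88WalkIdentity311`) is the inverse w.r.t. the classical `DecidableEq` of the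
    -- index type; the hypothesis is stated with that instance so that it is literally the abstract one
    (hCov : haveI : DecidableEq {x : α // blk x ∈ W} := fun a b => Classical.propDecidable (a = b)
      ∑ p, Cov p = (prec blk Δ W (corner ℝ W))⁻¹) (K : Finset κ) :
    ∫ φ, (((K.val.map fun j => (obs j : Multiset ({x : α // blk x ∈ W} → ℝ))).sum.map fun w => φ ⬝ᵥ w).prod
        * (χ φ * vexp c legs φ)) ∂(fieldLaw blk Δ ℱ W)
      = ∑ O ∈ K.powerset,
          (∑ π ∈ setPartitions (K \ O), ∏ Q ∈ π, flBlock Cov trig (src blk ℱ W) c legs obs M Q)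
            * ∑ 𝒳 ∈ ((expand Cov trig (src blk ℱ W) c legs obs M 0 O).map (rloc oc vc reg)).toFinset,
                remAt (prec blk Δ W (corner ℝ W)) Cov trig (src blk ℱ W) c legs obs M χ oc vc reg [] 0 O 𝒳
                  / ∫ φ, weight (prec blk Δ W (corner ℝ W)) φ * source (src blk ℱ W) φ := by
  have hZ := integral_density_pos blk Δ ℱ W hPD
  have h := located_display (trig := trig) (f := src blk ℱ W) (obs := obs) (M := M) oc vc reg hPD hχ h0 hCov K
  rw [gintM_eq_mul_integral_fieldLaw blk Δ ℱ W hPD, dlist_nil] at h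
  -- move `Z` to the other side
  have hR : (∑ O ∈ K.powerset,
        (∑ π ∈ setPartitions (K \ O), ∏ Q ∈ π, flBlock Cov trig (src blk ℱ W) c legs obs M Q)
          * ∑ 𝒳 ∈ ((expand Cov trig (src blk ℱ W) c legs obs M 0 O).map (rloc oc vc reg)).toFinset,
              remAt (prec blk Δ W (corner ℝ W)) Cov trig (src blk ℱ W) c legs obs M χ oc vc reg [] 0 O 𝒳
                / ∫ φ, weight (prec blk Δ W (corner ℝ W)) φ * source (src blk ℱ W) φ)
      = (∑ O ∈ K.powerset,
          (∑ π ∈ setPartitions (K \ O), ∏ Q ∈ π, flBlock Cov trig (src blk ℱ W) c legs obs M Q)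
            * ∑ 𝒳 ∈ ((expand Cov trig (src blk ℱ W) c legs obs M 0 O).map (rloc oc vc reg)).toFinset,
                remAt (prec blk Δ W (corner ℝ W)) Cov trig (src blk ℱ W) c legs obs M χ oc vc reg [] 0 O 𝒳)
          / ∫ φ, weight (prec blk Δ W (corner ℝ W)) φ * source (src blk ℱ W) φ := by
    rw [Finset.sum_div]
    refine Finset.sum_congr rfl fun O _ => ?_
    rw [mul_div_assoc, Finset.sum_div]
  rw [hR, eq_div_iff hZ.ne', ← h]
  ring

end Literature.MathematicalPhysics.QuantumFieldTheory.BalabanImbrieJaffe1984to88.BIJ88WalkLocatedDisplay312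

end
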